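import Literature.AlgebraicGeometry.Resolution.KawasakiPointwise
import Literature.AlgebraicGeometry.Resolution.KawasakiEmbeddedSelection
import Literature.AlgebraicGeometry.Resolution.KawasakiVanishingIdeal
import Literature.AlgebraicGeometry.Resolution.KawasakiChartStalk
import Literature.AlgebraicGeometry.Resolution.KawasakiChartValues
import Literature.AlgebraicGeometry.Resolution.CohenMacaulayClosedPoints
import Literature.AlgebraicGeometry.Resolution.MacaulayficationOfCMBlowup
import Literature.AlgebraicGeometry.Resolution.MacaulayficationProjectiveReduction
import Literature.AlgebraicGeometry.Resolution.BlowupsExistence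
import Literature.AlgebraicGeometry.Resolution.MonomialOrderReductionUnit
import Literature.AlgebraicGeometry.Resolution.AlterationsBoundarySmoothLocus
import Literature.AlgebraicGeometry.Resolution.PrincipalizationFromMacaulayfication
import HarnessLib

/-!
# Kawasaki's Macaulayfication theorem for integral schemes of finite type over a field

Topic: `Literature/AlgebraicGeometry/Resolution`. **Discharge of the named fact
`KawasakiMacaulayfication`** (`Macaulayfication.lean`; Kawasaki 2000, Thm. 1.1 for `A = k` a field and
`X` integral: every integral scheme separated and of finite type over a field has a proper
birational morphism from an integral scheme all of whose local rings are Cohen–Macaulay), as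
`kawasakiMacaulayfication_holds`. This file is the ASSEMBLY of the tree's formalization of
Kawasaki's proof:

* reductions: `kawasakiMacaulayfication_of_projective` (Chow's lemma + projective closure: integral
  closed subschemes of `ℙⁿ_k` suffice), `CohenMacaulayClosedPoints.lean` (closed points suffice),
  `MacaulayficationOfCMBlowup.macaulayfication_of_isBlowup` (a blowing up along a non-zero ideal
  sheaf with Cohen–Macaulay stalks is a Macaulayfication);
* the homogeneous prime `I_X` and `dim k[x]/I_X = dim X + 1` (`KawasakiVanishingIdeal.lean`), the
  forms `z_0, …, z_{d-1}` of La. 5.3 with their chart memberships and dimensions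
  (`KawasakiEmbeddedSelection.lean`, on `KawasakiFormSelection` / `KawasakiHomogeneousAnnihilator` /
  `KawasakiChartBaseChange` / `DehomogenizationChartPrimes`), the centre
  `∏_l (z_l, …, z_{d-1})𝒪_X` (`KawasakiCentreSheaf.lean`) and its blowing up (`BlowupsExistence`);
* the pointwise verification at a closed point over the centre — `cmClause_blowup_stalk_of_mem`:
  chart `D₊(x_j) ∋ p`, the cut `t` ("`z_t, …, z_{d-1} ∈ 𝔭`, `z_{t-1} ∉ 𝔭`", by `Nat.find`), the
  regular local ring `𝒪_{ℙⁿ,p}` and the base changes of the chart modules (`KawasakiChartStalk.lean`),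
  the chart values (`KawasakiChartValues.lean`), `dim 𝒪_{X,p} = dim X` at closed points, and
  `KawasakiPointwise.IsBlowup.cmClause_stalk_of_kawasakiCentreSheaf` (items 1–4 of p. 2539 +
  Cor. 4.2, `KawasakiBlowupStalks.lean`); off the centre — `cmClause_stalk_of_not_mem`
  (`KawasakiPointwise.cmClause_of_mem_extAnn_of_isUnit`) and the blowing up is an isomorphism there.

* `hasMacaulayfication_of_isClosedImmersion` — every integral closed subscheme of `ℙⁿ_k` has a
  Macaulayfication (dimension `0`: the identity);
* `kawasakiMacaulayfication_holds : KawasakiMacaulayfication`.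

Everything is proved; no named facts are used. One abbreviation (`kawasakiOverHom`, the embedding as a
morphism of `k`-schemes, the currency of `kawasakiCentreSheaf`).

## References

* T. Kawasaki, *On Macaulayfication of Noetherian schemes*, Trans. Amer. Math. Soc. 352 (2000)
  2517–2552: Thm. 1.1, Thm. 5.1 and its proof (p. 2538–2539), La. 5.3, Cor. 4.2. [Kawasaki2000]
* K. Česnavičius, *Macaulayfication of Noetherian schemes*, Duke Math. J. 170 (2021), Thm. 1.6,
  Thm. 5.3. [Cesnavicius2021]
* R. Hartshorne, *Algebraic Geometry* (1977), II Prop. 2.5, II Ex. 4.10 (Chow), II §5. [Hartshorne1977]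
-/

noncomputable section

open CategoryTheory AlgebraicGeometry TopologicalSpace HomogeneousLocalization MvPolynomial
open Literature.AlgebraicGeometry.Morphisms Literature.AlgebraicGeometry.Morphisms.ProjCech
open Literature.AlgebraicGeometry.Motives Literature.AlgebraicGeometry.Motives.ProjFrac
open Literature.AlgebraicGeometry.Motives.RatFn
open IsLocalRing RingTheory.Sequence

universe u

attribute [local instance] MvPolynomial.gradedAlgebra
  Literature.AlgebraicGeometry.Motives.ProjBaseChange.algebraBase

namespace Literature.AlgebraicGeometry.Resolution

variable {k : Type u} [Field k] {n : ℕ} {Z : Scheme.{u}} (ι : Z ⟶ PP k n) [IsClosedImmersion ι]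
  [IsIntegral Z]

/-! ## Charts: units and non-units among the germs of dehomogenised forms -/

omit [IsClosedImmersion ι] [IsIntegral Z] in
/-- `X ∩ D₊(x_j) ∩ D₊(G)` is the basic open of the chart value `G / x_j^m` on `X ∩ D₊(x_j)`.
[cite: Hartshorne1977, II Prop. 2.5 (b)] -/
theorem ZH_X_mul_eq_basicOpen (j : Fin (n + 1)) {m : ℕ} {G : MvPolynomial (Fin (n + 1)) k}
    (hG : G ∈ grading k n m) (hm : 0 < m) :
    ZH ι (X j * G) = Z.basicOpen (evalAway ι (X j) (dehomAway k n j G)) := by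
  rw [ZH_mul_eq_basicOpen_evalAway ι (Segre.X_mem k j) one_pos hG hm,
    ProjectiveSpace.isLocalizationElem_X j G hG]
  rfl

omit [IsClosedImmersion ι] [IsIntegral Z] in
/-- **The germ of `G / x_j^m` at `p ∈ X ∩ D₊(x_j)` is a unit iff `G` does not vanish at `p`**
(`p ∈ D₊(G)`). [cite: Hartshorne1977, II Prop. 2.5 (b)] -/
theorem isUnit_germ_evalAway_dehomAway_iff (j : Fin (n + 1)) {m : ℕ}
    {G : MvPolynomial (Fin (n + 1)) k} (hG : G ∈ grading k n m) (hm : 0 < m) {p : Z}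
    (hp : p ∈ ZH ι (X j : MvPolynomial (Fin (n + 1)) k)) :
    IsUnit (Z.presheaf.germ (ZH ι (X j)) p hp (evalAway ι (X j) (dehomAway k n j G))) ↔
      G ∉ (ι p).asHomogeneousIdeal := by
  rw [← Scheme.mem_basicOpen, ← ZH_X_mul_eq_basicOpen ι j hG hm, ZH_mul]
  change p ∈ ZH ι (X j) ∧ p ∈ ZH ι G ↔ _
  rw [and_iff_right hp]
  exact ProjectiveSpectrum.mem_basicOpen _ _ _

/-! ## The selection data of an embedded variety -/

omit [IsClosedImmersion ι] [IsIntegral Z] in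
/-- The standard charts `D₊(x_j)` cover `ℙⁿ`: every point of `X` lies in some `X ∩ D₊(x_j)`.
[cite: Hartshorne1977, II Prop. 2.5 (proof)] -/
theorem exists_mem_ZH_X (p : Z) :
    ∃ j : Fin (n + 1), p ∈ ZH ι (X j : MvPolynomial (Fin (n + 1)) k) := by
  have h : p ∈ (⊤ : Z.Opens) := trivial
  rw [← (GeneratingSections.ofHom ι).iSup_U, Opens.mem_iSup] at h
  exact h

omit [IsIntegral Z] in
/-- The embedding as a morphism of `k`-schemes `Z → ℙⁿ_k` (`Over` category), the currency of
`kawasakiCentreSheaf`. [folklore] -/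
abbrev kawasakiOverHom : (Over.mk (ι ≫ (projectiveSpace n k).hom) : SchemeOver k) ⟶ projectiveSpace n k :=
  Over.homMk ι rfl

/-! ## The stalks of the blowing up along Kawasaki's centre, at closed points over the centre -/

/-- **Kawasaki's verification at a closed point over the centre** (proof of Thm. 5.1, p. 2539, the
case `𝔟 ⊆ 𝔭`), assembled: `Z ⊆ ℙⁿ_k` integral closed of dimension `d`, forms `z_0, …, z_{d-1}` of
positive degree in Kawasaki's order whose chart values satisfy, on every chart `D₊(x_j)`, the
dimension bounds `dim Γ(Z, Z_{x_j}) ⧸ (z_l, …, z_{d-1}) ≤ l` and the memberships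
`z_l / x_j^{N_l} ∈ 𝔞(Γ(Z, Z_{x_j}) ⧸ (z_{l+1}, …, z_{d-1}))` (window `(n - (l+1), max n 2]`),
`π : X' → Z` the blowing up along `∏_l (z_l, …, z_{d-1})𝒪_Z`, `x' ∈ X'` a closed point whose
image lies in `V₊(z_{d-1})`: then every system of parameters of `𝒪_{X',x'}` is weakly regular. The
chart `j ∋ π x'`, the cut `t` ("`z_t, …, z_{d-1} ∈ 𝔭`, `z_{t-1} ∉ 𝔭`"), the regular local ring
`𝒪_{ℙⁿ, π x'}` with the base changes of the chart modules (`KawasakiChartStalk.lean`), the chart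
values (`KawasakiChartValues.lean`) and `dim 𝒪_{Z,π x'} = d` (`ringKrullDim_stalk_eq_of_isClosed`)
feed `IsBlowup.cmClause_stalk_of_kawasakiCentreSheaf`. [cite: Kawasaki2000, Thm. 5.1 (proof, p. 2539)] -/
theorem cmClause_blowup_stalk_of_mem (f : Z ⟶ Spec (.of k)) [LocallyOfFiniteType f]
    {d : ℕ} (hd : topologicalKrullDim Z = d)
    (z : Fin d → MvPolynomial (Fin (n + 1)) k) (N : Fin d → ℕ) (hN : ∀ i, 0 < N i)
    (hz : ∀ i, (z i).IsHomogeneous (N i))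
    (hdimI : ∀ (j : Fin (n + 1)), genericPoint Z ∈ ZH ι (X j : MvPolynomial (Fin (n + 1)) k) →
      ∀ (l : ℕ), l < d →
      ringKrullDim (ChartQuot ι (X j) (Ideal.ofList (((List.ofFn fun i => Away.mk (grading k n)
        (Segre.X_mem k j) (N i) (z i) (mem_grading_smul_one_of_isHomogeneous (hz i))).drop l).map
          (evalAway ι (X j))))) ≤ l)
    (hannI : ∀ (j : Fin (n + 1)), genericPoint Z ∈ ZH ι (X j : MvPolynomial (Fin (n + 1)) k) →
      ∀ (l : Fin d),
      Away.mk (grading k n) (Segre.X_mem k j) (N l) (z l) (mem_grading_smul_one_of_isHomogeneous (hz l)) ∈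
        extAnn (Away (grading k n) (X j : MvPolynomial (Fin (n + 1)) k))
          (ChartQuot ι (X j) (Ideal.ofList (((List.ofFn fun i => Away.mk (grading k n)
            (Segre.X_mem k j) (N i) (z i) (mem_grading_smul_one_of_isHomogeneous (hz i))).drop
              (l + 1)).map (evalAway ι (X j)))))
          (Finset.Ioc (n - (l + 1)) (max n 2)))
    {X' : Scheme.{u}} {π : X' ⟶ Z} (hπ : IsBlowup π (kawasakiCentreSheaf (kawasakiOverHom ι) z N hz))
    (x' : X') (hx'c : IsClosed ({x'} : Set X')) (hd0 : 0 < d)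
    (hsupp : z ⟨d - 1, by omega⟩ ∈ (ι (π x')).asHomogeneousIdeal) :
    ∀ e : ℕ, ringKrullDim (X'.presheaf.stalk x') = e → ∀ s : Fin e → X'.presheaf.stalk x',
      (Ideal.span (Set.range s)).radical.IsMaximal →
        IsWeaklyRegular (X'.presheaf.stalk x') (List.ofFn s) := by
  classical
  haveI : IsLocallyNoetherian Z := LocallyOfFiniteType.isLocallyNoetherian f
  haveI : IsProper π := hπ.isProper
  -- the image point and a chart containing it
  have hpc : IsClosed ({π x'} : Set Z) := by
    simpa only [Set.image_singleton] using π.isClosedMap _ hx'c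
  obtain ⟨j, hp⟩ := exists_mem_ZH_X ι (π x')
  let x : ZH ι (X j : MvPolynomial (Fin (n + 1)) k) := ⟨π x', hp⟩
  letI := chartLocalStalkAlgebra ι j x
  letI := awayStalkAlgebra ι j x
  haveI := isScalarTower_chartLocal_stalk ι j x
  haveI := isRegularLocalRing_chartLocal ι j x
  -- the chart elements `g_i = z_i / x_j^{N_i}`
  set g : Fin d → Away (grading k n) (X j : MvPolynomial (Fin (n + 1)) k) := fun i =>
    Away.mk (grading k n) (Segre.X_mem k j) (N i) (z i) (mem_grading_smul_one_of_isHomogeneous (hz i))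
    with hgdef
  have hg_eq : ∀ i, dehomAway k n j (z i) = g i := fun i =>
    dehomAway_of_mem j (hz i : z i ∈ grading k n (N i))
  -- vanishing of `z_i` at `π x'` read on the germs of the `g_i`
  have hV : ∀ i : Fin d, algebraMap _ (Z.presheaf.stalk (π x')) (g i) ∈
      maximalIdeal (Z.presheaf.stalk (π x')) ↔ z i ∈ (ι (π x')).asHomogeneousIdeal := by
    intro i
    have h1 : algebraMap _ (Z.presheaf.stalk (π x')) (g i) =
        (Z.presheaf.germ (ZH ι (X j)) (π x') hp).hom (evalAway ι (X j) (dehomAway k n j (z i))) :=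
      (awayStalkAlgebra_algebraMap_apply ι j x (g i)).trans (by rw [hg_eq i]; rfl)
    rw [h1, IsLocalRing.mem_maximalIdeal, mem_nonunits_iff,
      isUnit_germ_evalAway_dehomAway_iff ι j (hz i : z i ∈ grading k n (N i)) (hN i) hp, not_not]
  -- the cut `t`: `z_t, …, z_{d-1}` vanish at `π x'`, `z_{t-1}` does not
  have hex : ∃ t : ℕ, ∀ i : Fin d, t ≤ (i : ℕ) →
      algebraMap _ (Z.presheaf.stalk (π x')) (g i) ∈ maximalIdeal (Z.presheaf.stalk (π x')) := by
    refine ⟨d - 1, fun i hi => ?_⟩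
    have hi' : i = ⟨d - 1, by omega⟩ := Fin.ext (by simp only; omega)
    rw [hi']
    exact (hV _).mpr hsupp
  have htd : Nat.find hex < d :=
    lt_of_le_of_lt (Nat.find_min' hex (m := d - 1) (fun i hi => by
      have hi' : i = ⟨d - 1, by omega⟩ := Fin.ext (by simp only; omega)
      rw [hi']
      exact (hV _).mpr hsupp)) (by omega)
  have hmem : ∀ i : Fin d, Nat.find hex ≤ (i : ℕ) →
      algebraMap _ (Z.presheaf.stalk (π x')) (g i) ∈ maximalIdeal (Z.presheaf.stalk (π x')) :=
    Nat.find_spec hex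
  have hunit : ∀ h0 : 0 < Nat.find hex,
      IsUnit (algebraMap _ (Z.presheaf.stalk (π x')) (g ⟨Nat.find hex - 1, by omega⟩)) := by
    intro h0
    by_contra hu
    have hm : algebraMap _ (Z.presheaf.stalk (π x')) (g ⟨Nat.find hex - 1, by omega⟩) ∈
        maximalIdeal (Z.presheaf.stalk (π x')) :=
      (IsLocalRing.mem_maximalIdeal _).mpr (mem_nonunits_iff.mpr hu)
    refine Nat.find_min hex (m := Nat.find hex - 1) (by omega) fun i hi => ?_
    by_cases hi' : Nat.find hex ≤ (i : ℕ)
    · exact hmem i hi'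
    · have hi'' : i = ⟨Nat.find hex - 1, by omega⟩ := Fin.ext (by simp only; omega)
      rw [hi'']
      exact hm
  -- dimension of the stalk
  have hdim : ringKrullDim (Z.presheaf.stalk (π x')) = d := by
    rw [ringKrullDim_stalk_eq_of_isClosed f hpc, hd]
  -- instances for the centre's scheme `Y = Over.mk (ι ≫ _)` (`Y.left` is `Z` by `rfl`)
  haveI : IsAffineHom (kawasakiOverHom ι).left := by change IsAffineHom ι; infer_instance
  haveI : QuasiSeparatedSpace (Over.mk (ι ≫ (projectiveSpace n k).hom) : SchemeOver k).left := by
    change QuasiSeparatedSpace Z; infer_instance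
  haveI : IsIntegral (Over.mk (ι ≫ (projectiveSpace n k).hom) : SchemeOver k).left := by
    change IsIntegral Z; infer_instance
  haveI : IsLocallyNoetherian (Over.mk (ι ≫ (projectiveSpace n k).hom) : SchemeOver k).left := by
    change IsLocallyNoetherian Z; infer_instance
  letI : Algebra (ChartLocal ι j x)
      ((Over.mk (ι ≫ (projectiveSpace n k).hom) : SchemeOver k).left.presheaf.stalk (π x')) :=
    chartLocalStalkAlgebra ι j x
  letI : Algebra (Away (grading k n) (X j : MvPolynomial (Fin (n + 1)) k))
      ((Over.mk (ι ≫ (projectiveSpace n k).hom) : SchemeOver k).left.presheaf.stalk (π x')) :=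
    awayStalkAlgebra ι j x
  haveI : IsScalarTower (Away (grading k n) (X j : MvPolynomial (Fin (n + 1)) k)) (ChartLocal ι j x)
      ((Over.mk (ι ≫ (projectiveSpace n k).hom) : SchemeOver k).left.presheaf.stalk (π x')) :=
    isScalarTower_chartLocal_stalk ι j x
  haveI : IsRegularLocalRing (ChartLocal ι j x) := isRegularLocalRing_chartLocal ι j x
  -- the germs of the chart values
  have hgerm : ∀ l : Fin d, algebraMap _ (Z.presheaf.stalk (π x')) (g l) =
      ((Over.mk (ι ≫ (projectiveSpace n k).hom) : SchemeOver k).left.presheaf.germ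
        ((GeneratingSections.ofHom (kawasakiOverHom ι).left).U j) (π x') hp).hom
        (chartVal (kawasakiOverHom ι) z N hz l j) := fun l =>
    (awayStalkAlgebra_algebraMap_apply ι j x (g l)).trans
      (algebraMap_evalAway_mk_eq_germ_chartVal (kawasakiOverHom ι) z N hz l j x)
  exact IsBlowup.cmClause_stalk_of_kawasakiCentreSheaf (kawasakiOverHom ι) z N hz hπ x' j hp
    ((projChartPrime ι j x).asIdeal.primeCompl) (chartLocalToStalk_surjective ι j x)
    (ringKrullDim_chartLocal ι j x hpc) hdim g hgerm htd hmem hunit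
    (fun l => stalkIdealMap ι j x (Ideal.ofList (((List.ofFn g).drop l).map (evalAway ι (X j)))))
    (fun l _ _ => stalkIdealMap_ofList_eq ι j x _)
    (fun l _ hld => (ringKrullDim_stalkQuot_le ι j x _).trans (hdimI j (genericPoint_mem_of_mem hp) l hld))
    (fun l => ChartQuot ι (X j) (Ideal.ofList (((List.ofFn g).drop l).map (evalAway ι (X j)))))
    (fun l => chartQuotToStalkQuot ι j x _) (fun l _ _ => isBaseChange_chartQuotToStalkQuot ι j x _)
    (fun l _ => hannI j (genericPoint_mem_of_mem hp) l)

/-- **Kawasaki's verification at a closed point off the centre** (proof of Thm. 5.1, p. 2539, the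
case `𝔟 ⊄ 𝔭`: "`∏ ann Hʲ(D) ⊄ 𝔭`. Hence `𝒪_{Y,q} = R_(𝔭)` is Cohen–Macaulay"): with the data of
`cmClause_blowup_stalk_of_mem`, at a closed point `p ∈ Z` where `z_{d-1}` does not vanish, every
system of parameters of `𝒪_{Z,p}` is weakly regular (`cmClause_of_mem_extAnn_of_isUnit` on a chart
`D₊(x_j) ∋ p`, the unit being the germ of `z_{d-1} / x_j^{N_{d-1}}`).
[cite: Kawasaki2000, Thm. 5.1 (proof, p. 2539)] -/
theorem cmClause_stalk_of_not_mem (f : Z ⟶ Spec (.of k)) [LocallyOfFiniteType f]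
    {d : ℕ} (hd : topologicalKrullDim Z = d)
    (z : Fin d → MvPolynomial (Fin (n + 1)) k) (N : Fin d → ℕ) (hN : ∀ i, 0 < N i)
    (hz : ∀ i, (z i).IsHomogeneous (N i))
    (hannI : ∀ (j : Fin (n + 1)), genericPoint Z ∈ ZH ι (X j : MvPolynomial (Fin (n + 1)) k) →
      ∀ (l : Fin d),
      Away.mk (grading k n) (Segre.X_mem k j) (N l) (z l) (mem_grading_smul_one_of_isHomogeneous (hz l)) ∈
        extAnn (Away (grading k n) (X j : MvPolynomial (Fin (n + 1)) k))
          (ChartQuot ι (X j) (Ideal.ofList (((List.ofFn fun i => Away.mk (grading k n)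
            (Segre.X_mem k j) (N i) (z i) (mem_grading_smul_one_of_isHomogeneous (hz i))).drop
              (l + 1)).map (evalAway ι (X j)))))
          (Finset.Ioc (n - (l + 1)) (max n 2)))
    (p : Z) (hpc : IsClosed ({p} : Set Z)) (hd0 : 0 < d)
    (hnot : z ⟨d - 1, by omega⟩ ∉ (ι p).asHomogeneousIdeal) :
    ∀ e : ℕ, ringKrullDim (Z.presheaf.stalk p) = e → ∀ s : Fin e → Z.presheaf.stalk p,
      (Ideal.span (Set.range s)).radical.IsMaximal →
        IsWeaklyRegular (Z.presheaf.stalk p) (List.ofFn s) := by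
  classical
  haveI : IsLocallyNoetherian Z := LocallyOfFiniteType.isLocallyNoetherian f
  obtain ⟨j, hp⟩ := exists_mem_ZH_X ι p
  let x : ZH ι (X j : MvPolynomial (Fin (n + 1)) k) := ⟨p, hp⟩
  letI := chartLocalStalkAlgebra ι j x
  letI := awayStalkAlgebra ι j x
  haveI := isScalarTower_chartLocal_stalk ι j x
  haveI := isRegularLocalRing_chartLocal ι j x
  set g : Fin d → Away (grading k n) (X j : MvPolynomial (Fin (n + 1)) k) := fun i =>
    Away.mk (grading k n) (Segre.X_mem k j) (N i) (z i) (mem_grading_smul_one_of_isHomogeneous (hz i))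
    with hgdef
  have hg_eq : ∀ i, dehomAway k n j (z i) = g i := fun i =>
    dehomAway_of_mem j (hz i : z i ∈ grading k n (N i))
  -- the unit
  have hu : IsUnit (algebraMap _ (Z.presheaf.stalk p) (g ⟨d - 1, by omega⟩)) := by
    have h1 : algebraMap _ (Z.presheaf.stalk p) (g ⟨d - 1, by omega⟩) =
        (Z.presheaf.germ (ZH ι (X j)) p hp).hom (evalAway ι (X j) (dehomAway k n j (z ⟨d - 1, by omega⟩))) :=
      (awayStalkAlgebra_algebraMap_apply ι j x (g _)).trans (by rw [hg_eq]; rfl)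
    rw [h1, isUnit_germ_evalAway_dehomAway_iff ι j (hz _ : z _ ∈ grading k n (N _)) (hN _) hp]
    exact hnot
  -- the top level: `J = 0`
  have hdrop : ((List.ofFn g).drop ((d - 1) + 1)).map (evalAway ι (X j)) = [] := by
    rw [List.drop_of_length_le (by simp; omega), List.map_nil]
  have hJ : stalkIdealMap ι j x (Ideal.ofList (((List.ofFn g).drop ((d - 1) + 1)).map
      (evalAway ι (X j)))) = ⊥ := by
    rw [hdrop, Ideal.ofList_nil, stalkIdealMap, Ideal.map_bot]
  have hdim : ringKrullDim (Z.presheaf.stalk p) = d := by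
    rw [ringKrullDim_stalk_eq_of_isClosed f hpc, hd]
  exact cmClause_of_mem_extAnn_of_isUnit ((projChartPrime ι j x).asIdeal.primeCompl)
    (chartLocalToStalk_surjective ι j x) (ringKrullDim_chartLocal ι j x hpc) hdim
    (M := ChartQuot ι (X j) (Ideal.ofList (((List.ofFn g).drop ((d - 1) + 1)).map
      (evalAway ι (X j)))))
    _ hJ (chartQuotToStalkQuot ι j x _) (isBaseChange_chartQuotToStalkQuot ι j x _)
    (by
      have h := hannI j (genericPoint_mem_of_mem hp) ⟨d - 1, by omega⟩
      have hw : n - (d - 1 + 1) = n - d := by omega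
      rw [hw] at h
      exact h)
    hu

/-! ## Kawasaki's Macaulayfication of an embedded integral projective variety -/

include ι in
/-- **Macaulayfication of an integral closed subscheme of `ℙⁿ_k`** (Kawasaki 2000, Thm. 5.1 for
`X ⊆ ℙⁿ_k` integral, assembled): the blowing up of `X` along Kawasaki's centre
`∏_l (z_l, …, z_{d-1})𝒪_X` — `z_0, …, z_{d-1}` the forms of La. 5.3 for the homogeneous prime `I_X`
(`KawasakiVanishingIdeal.lean`, `KawasakiEmbeddedSelection.lean`), `d = dim X ≥ 1` — is a proper
birational morphism from an integral scheme all of whose local rings are Cohen–Macaulay (closed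
points over the centre: `cmClause_blowup_stalk_of_mem`; closed points off the centre: the blowing up
is an isomorphism there and `cmClause_stalk_of_not_mem`; all points: `cmClause_of_closedPoints`).
For `dim X = 0` the identity is a Macaulayfication. [cite: Kawasaki2000, Thm. 5.1] -/
theorem hasMacaulayfication_of_isClosedImmersion : Scheme.HasMacaulayfication Z := by
  classical
  -- finiteness over `k`
  haveI : @LocallyOfFiniteType (PP k n) (Spec (.of k)) (projectiveSpace n k).hom := by
    change LocallyOfFiniteType (projectiveSpace n k).hom
    infer_instance
  let f : Z ⟶ Spec (.of k) := ι ≫ ((projectiveSpace n k).hom : PP k n ⟶ Spec (.of k))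
  haveI : LocallyOfFiniteType f :=
    inferInstanceAs (LocallyOfFiniteType (ι ≫ ((projectiveSpace n k).hom : PP k n ⟶ Spec (.of k))))
  haveI : IsLocallyNoetherian Z := LocallyOfFiniteType.isLocallyNoetherian f
  -- a chart through the generic point, and the dimension
  obtain ⟨j₀, hj₀⟩ := exists_mem_ZH_X ι (genericPoint Z)
  haveI : Algebra.FiniteType k (Away (grading k n) (X j₀ : MvPolynomial (Fin (n + 1)) k)) :=
    (inferInstance : Algebra.FiniteType k (MvPolynomial (Fin n) k)).equiv
      (ProjectiveSpace.chartAlgEquiv k j₀).symm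
  obtain ⟨d, hd⟩ : ∃ d : ℕ, topologicalKrullDim Z = d := by
    haveI : Nonempty (ZH ι (X j₀ : MvPolynomial (Fin (n + 1)) k)) := ⟨⟨_, hj₀⟩⟩
    haveI : (RingHom.ker (evalAway ι (X j₀ : MvPolynomial (Fin (n + 1)) k))).IsPrime :=
      RingHom.ker_isPrime _
    obtain ⟨d, hd', -⟩ := Literature.RingTheory.KrullDimension.exists_ringKrullDim_eq_and_trdeg_eq k
      (Away (grading k n) (X j₀ : MvPolynomial (Fin (n + 1)) k) ⧸ RingHom.ker (evalAway ι (X j₀)))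
    refine ⟨d, ?_⟩
    rw [topologicalKrullDim_eq_ringKrullDim_of_isAffineOpen f (isAffineOpen_ZH_X ι j₀) ⟨_, hj₀⟩,
      ← ringKrullDim_eq_of_ringEquiv (RingHom.quotientKerEquivOfSurjective
        (evalAway_surjective ι (Segre.X_mem k j₀) one_pos)), hd']
  rcases Nat.eq_zero_or_pos d with hd0 | hd0
  · -- `dim X = 0`: every closed point has a zero-dimensional local ring; the identity works
    refine ⟨Z, 𝟙 Z, inferInstance, ⟨⊤, by simp, by simp, inferInstance⟩, inferInstance, ?_⟩
    refine cmClause_of_closedPoints_of_locallyOfFiniteType f fun y hyc e he s _ => ?_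
    have h0 : ringKrullDim (Z.presheaf.stalk y) = (0 : ℕ) := by
      rw [ringKrullDim_stalk_eq_of_isClosed f hyc, hd, hd0]
    rw [h0] at he
    have he0 : e = 0 := by exact_mod_cast he.symm
    subst he0
    rw [List.ofFn_zero]
    exact IsWeaklyRegular.nil _ _
  -- `dim X = d ≥ 1`: the homogeneous prime `P = I_X` and Kawasaki's forms
  haveI := isPrime_projVanishingIdeal ι j₀ hj₀
  obtain ⟨z, N, hN, hz, hlast, hdimJ, hann⟩ := exists_kawasakiForms ι (projVanishingIdeal ι j₀ hj₀)
    (isHomogeneous_projVanishingIdeal ι j₀ hj₀) hd0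
    (ringKrullDim_quotient_projVanishingIdeal ι j₀ hj₀ f hd)
  -- read on the charts meeting `X`
  have hPchart : ∀ j : Fin (n + 1), genericPoint Z ∈ ZH ι (X j : MvPolynomial (Fin (n + 1)) k) →
      (projVanishingIdeal ι j₀ hj₀).map (dehomAway k n j) ≤ RingHom.ker (evalAway ι (X j)) :=
    fun j hj => (map_dehomAway_projVanishingIdeal_eq ι j₀ hj₀ hj).le
  have hJhom : ∀ l : ℕ, (projVanishingIdeal ι j₀ hj₀ ⊔
      Ideal.span (z '' {i : Fin d | l ≤ (i : ℕ)})).IsHomogeneous (grading k n) := fun l =>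
    Ideal.IsHomogeneous.sup (isHomogeneous_projVanishingIdeal ι j₀ hj₀)
      (Ideal.homogeneous_span _ _ (by rintro _ ⟨i, -, rfl⟩; exact ⟨N i, hz i⟩))
  have hdimI : ∀ (j : Fin (n + 1)), genericPoint Z ∈ ZH ι (X j : MvPolynomial (Fin (n + 1)) k) →
      ∀ (l : ℕ), l < d →
      ringKrullDim (ChartQuot ι (X j) (Ideal.ofList (((List.ofFn fun i => Away.mk (grading k n)
        (Segre.X_mem k j) (N i) (z i) (mem_grading_smul_one_of_isHomogeneous (hz i))).drop l).map
          (evalAway ι (X j))))) ≤ l := by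
    intro j hj l hl
    rw [← chartIdealOf_sup_span_image_eq_ofList ι (hPchart j hj) z N hz l]
    exact ringKrullDim_chartQuot_chartIdealOf_le ι (hJhom l) (by rw [hdimJ l hl.le]) j
  have hannI : ∀ (j : Fin (n + 1)), genericPoint Z ∈ ZH ι (X j : MvPolynomial (Fin (n + 1)) k) →
      ∀ (l : Fin d),
      Away.mk (grading k n) (Segre.X_mem k j) (N l) (z l) (mem_grading_smul_one_of_isHomogeneous (hz l)) ∈
        extAnn (Away (grading k n) (X j : MvPolynomial (Fin (n + 1)) k))
          (ChartQuot ι (X j) (Ideal.ofList (((List.ofFn fun i => Away.mk (grading k n)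
            (Segre.X_mem k j) (N i) (z i) (mem_grading_smul_one_of_isHomogeneous (hz i))).drop
              (l + 1)).map (evalAway ι (X j)))))
          (Finset.Ioc (n - (l + 1)) (max n 2)) := by
    intro j hj l
    have h := hann l j
    rw [chartIdealOf_sup_span_image_eq_ofList ι (hPchart j hj) z N hz (l + 1),
      dehomAway_of_mem j (hz l : z l ∈ grading k n (N l))] at h
    exact h
  -- instances for the scheme `Y = Over.mk (ι ≫ _)` over `k` (`Y.left` is `Z` by `rfl`)
  haveI : IsAffineHom (kawasakiOverHom ι).left := by change IsAffineHom ι; infer_instance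
  haveI : QuasiSeparatedSpace (Over.mk (ι ≫ (projectiveSpace n k).hom) : SchemeOver k).left := by
    change QuasiSeparatedSpace Z; infer_instance
  haveI : IsIntegral (Over.mk (ι ≫ (projectiveSpace n k).hom) : SchemeOver k).left := by
    change IsIntegral Z; infer_instance
  haveI : IsLocallyNoetherian (Over.mk (ι ≫ (projectiveSpace n k).hom) : SchemeOver k).left := by
    change IsLocallyNoetherian Z; infer_instance
  -- the centre is a non-zero ideal sheaf: `z_{d-1} ∉ I_X` does not vanish at the generic point
  have hN' : 0 < N ⟨d - 1, by omega⟩ := hN _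
  have hcentre : kawasakiCentreSheaf (kawasakiOverHom ι) z N hz ≠ ⊥ := by
    refine kawasakiCentreSheaf_ne_bot (kawasakiOverHom ι) z N hz hd0 hN' ⟨genericPoint Z, ?_⟩
    change z ⟨d - 1, by omega⟩ ∉ (ι (genericPoint Z)).asHomogeneousIdeal
    rw [← isUnit_germ_evalAway_dehomAway_iff ι j₀ (hz _ : z _ ∈ grading k n (N _)) hN' hj₀,
      isUnit_iff_ne_zero]
    intro h0
    apply hlast
    rw [mem_projVanishingIdeal_iff ι j₀ hj₀ hj₀ (hz _ : z _ ∈ grading k n (N _))]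
    exact germ_injective_of_isIntegral Z (genericPoint Z) hj₀ (h0.trans (map_zero _).symm)
  -- blow up
  obtain ⟨X', π, hπ⟩ := exists_isBlowup Z (kawasakiCentreSheaf (kawasakiOverHom ι) z N hz)
  haveI : IsProper π := hπ.isProper
  have hCM : ∀ x' : X', ∀ e : ℕ, ringKrullDim (X'.presheaf.stalk x') = e →
      ∀ s : Fin e → X'.presheaf.stalk x', (Ideal.span (Set.range s)).radical.IsMaximal →
        IsWeaklyRegular (X'.presheaf.stalk x') (List.ofFn s) := by
    refine cmClause_of_closedPoints_of_locallyOfFiniteType (π ≫ f) fun x' hx'c => ?_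
    by_cases hmem : z ⟨d - 1, by omega⟩ ∈ (ι (π x')).asHomogeneousIdeal
    · exact cmClause_blowup_stalk_of_mem ι f hd z N hN hz hdimI hannI hπ x' hx'c hd0 hmem
    · have hnot : π x' ∉ (kawasakiCentreSheaf (kawasakiOverHom ι) z N hz).support := fun h =>
        hmem ((mem_support_kawasakiCentreSheaf_iff (kawasakiOverHom ι) z N hz hd0 hN' (π x')).mp h)
      haveI := hπ.isIso_stalkMap_of_not_mem_support hnot
      have hpc : IsClosed ({π x'} : Set Z) := by
        simpa only [Set.image_singleton] using π.isClosedMap _ hx'c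
      exact cmClause_of_ringEquiv (asIso (π.stalkMap x')).commRingCatIsoToRingEquiv
        (cmClause_stalk_of_not_mem ι f hd z N hN hz hannI (π x') hpc hd0 hmem)
  obtain ⟨hprop, hbir, hint, hcm⟩ := macaulayfication_of_isBlowup f hcentre hπ hCM
  exact ⟨X', π, hprop, hbir, hint, hcm⟩

/-! ## The named fact -/

/-- **Kawasaki's Macaulayfication theorem** in the form of the named fact `KawasakiMacaulayfication`
(Kawasaki 2000, Thm. 1.1 for `A = k` a field and `X` integral): every integral scheme separated and
of finite type over a field admits a proper birational morphism from an integral scheme all of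
whose local rings are Cohen–Macaulay. By Chow's lemma and projective closure
(`kawasakiMacaulayfication_of_projective`) it suffices to treat integral closed subschemes of `ℙⁿ_k`
(`hasMacaulayfication_of_isClosedImmersion`). [cite: Kawasaki2000, Thm. 1.1] -/
theorem kawasakiMacaulayfication_holds : KawasakiMacaulayfication.{u} :=
  kawasakiMacaulayfication_of_projective fun k _ n X ι hι hX => by
    exact @hasMacaulayfication_of_isClosedImmersion k _ n X ι hι hX

end Literature.AlgebraicGeometry.Resolution

end
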